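import Summits.Ventures.PercRepro.C025ProfilePavingPLD
import Summits.Ventures.PercRepro.C025ProfilePavingPLDLoops
import Summits.Ventures.PercRepro.C025ProfilePavingPLDGirth
import Summits.Ventures.PercRepro.C025ProfilePLDClosureParallel

/-!
# C-025 ON EVERY TRUNCATION OF «PAVING ⊕ PARALLEL CLASSES ⊕ FREE POINTS» AND FRIENDS; THE COMPLEMENT SYMMETRY
(night-3 g29)

`proofs/NIGHT3-G29-PARALLEL.md` §4.  The closure theorem `PLDClosure.pld_disjointSum_parallelClasses` composed with
g28's PER-LAYER DOMINANCE theorems: C-025 holds at every `(p, q)` on every truncation of `M ⊕ (parallel classes) ⊕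
(free points)` for `M` paving (`rls_truncate_paving_parallelClasses_freeOn`), for `M` of rank `≤ 2`
(`rls_truncate_eRank_le_two_parallelClasses_freeOn`), for `M` paving-with-loops (`…_paving_loops_…`), and at levels
`r ≤ g` for `M` of girth `≥ g` (`rls_truncate_girth_parallelClasses_freeOn`, through the truncation at the girth, which
is paving, and `PavingPLD.truncate_disjointSum_truncate`).  None of these classes is paving or of rank `≤ 2`.
`sum_complement`: the rank profile of a finite matroid is symmetric — the complement `I ↦ E ∖ I` is an involution of the
subsets exchanging `ρ(I)` and `ρ(E ∖ I)` — the one fact beyond (PLD) that the closure under rank-`≥ 2` uniform flats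
needs (paper §4 (IX): at the array level that closure is false without it).
No `def`, no `instance`, no notation.  Axioms: standard.
-/

open scoped Matroid

namespace PercRepro

open Finset ThmH

namespace PLDClosure

variable {α β : Type} [DecidableEq α] [DecidableEq β]

/-- C-025 AT EVERY `(p, q)` ON EVERY TRUNCATION OF «PAVING ⊕ PARALLEL CLASSES ⊕ FREE POINTS». -/
theorem rls_truncate_paving_parallelClasses_freeOn (M : Matroid α) [M.Finite]
    (hpav : ∀ C, M.IsCircuit C → M.eRank ≤ C.encard) (c : α → β) (E₂ : Finset α) (h : Disjoint M.E (E₂ : Set α))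
    (E₃ : Finset α)
    (h₃ : Disjoint (M.disjointSum ((Matroid.freeOn (Set.univ : Set β)).comapOn (E₂ : Set α) c) h).E (E₃ : Set α))
    (r p q : ℕ) :
    haveI := disjointSum_comapOn_finite M c E₂ h
    haveI := PLDBridge.disjointSum_freeOn_finite _ E₃ h₃
    ThmN.RLS (PercRepro.Matroid.truncate
      ((M.disjointSum ((Matroid.freeOn (Set.univ : Set β)).comapOn (E₂ : Set α) c) h).disjointSum
        (Matroid.freeOn (E₃ : Set α)) h₃) r) p q :=
  rls_truncate_disjointSum_parallelClasses_freeOn_of_pld M (PavingPLD.pld_of_paving M hpav) c E₂ h E₃ h₃ r p q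

/-- C-025 AT EVERY `(p, q)` ON EVERY TRUNCATION OF «RANK ≤ 2 ⊕ PARALLEL CLASSES ⊕ FREE POINTS». -/
theorem rls_truncate_eRank_le_two_parallelClasses_freeOn (M : Matroid α) [M.Finite] (hM : M.eRank ≤ 2)
    (c : α → β) (E₂ : Finset α) (h : Disjoint M.E (E₂ : Set α)) (E₃ : Finset α)
    (h₃ : Disjoint (M.disjointSum ((Matroid.freeOn (Set.univ : Set β)).comapOn (E₂ : Set α) c) h).E (E₃ : Set α))
    (r p q : ℕ) :
    haveI := disjointSum_comapOn_finite M c E₂ h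
    haveI := PLDBridge.disjointSum_freeOn_finite _ E₃ h₃
    ThmN.RLS (PercRepro.Matroid.truncate
      ((M.disjointSum ((Matroid.freeOn (Set.univ : Set β)).comapOn (E₂ : Set α) c) h).disjointSum
        (Matroid.freeOn (E₃ : Set α)) h₃) r) p q :=
  rls_truncate_disjointSum_parallelClasses_freeOn_of_pld M (PavingPLD.pld_of_eRank_le_two M hM) c E₂ h E₃ h₃ r p q

/-- C-025 AT EVERY `(p, q)` ON EVERY TRUNCATION OF «PAVING-WITH-LOOPS ⊕ PARALLEL CLASSES ⊕ FREE POINTS». -/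
theorem rls_truncate_paving_loops_parallelClasses_freeOn (M : Matroid α) [M.Finite]
    (hpav : ∀ C, M.IsCircuit C → C.encard = 1 ∨ M.eRank ≤ C.encard) (c : α → β) (E₂ : Finset α)
    (h : Disjoint M.E (E₂ : Set α)) (E₃ : Finset α)
    (h₃ : Disjoint (M.disjointSum ((Matroid.freeOn (Set.univ : Set β)).comapOn (E₂ : Set α) c) h).E (E₃ : Set α))
    (r p q : ℕ) :
    haveI := disjointSum_comapOn_finite M c E₂ h
    haveI := PLDBridge.disjointSum_freeOn_finite _ E₃ h₃
    ThmN.RLS (PercRepro.Matroid.truncate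
      ((M.disjointSum ((Matroid.freeOn (Set.univ : Set β)).comapOn (E₂ : Set α) c) h).disjointSum
        (Matroid.freeOn (E₃ : Set α)) h₃) r) p q :=
  rls_truncate_disjointSum_parallelClasses_freeOn_of_pld M (PavingPLD.pld_of_paving_loops M hpav) c E₂ h E₃ h₃ r p q

/-- C-025 AT EVERY `(p, q)` AT LEVELS `r ≤ g` ON «ANY MATROID OF GIRTH ≥ g ⊕ PARALLEL CLASSES ⊕ FREE POINTS»: the
truncation at the girth is paving and commutes with the two direct sums below `g`. -/
theorem rls_truncate_girth_parallelClasses_freeOn (M : Matroid α) [M.Finite] (g : ℕ)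
    (hg : ∀ C, M.IsCircuit C → (g : ℕ∞) ≤ C.encard) (c : α → β) (E₂ : Finset α) (h : Disjoint M.E (E₂ : Set α))
    (E₃ : Finset α)
    (h₃ : Disjoint (M.disjointSum ((Matroid.freeOn (Set.univ : Set β)).comapOn (E₂ : Set α) c) h).E (E₃ : Set α))
    (r : ℕ) (hr : r ≤ g) (p q : ℕ) :
    haveI := disjointSum_comapOn_finite M c E₂ h
    haveI := PLDBridge.disjointSum_freeOn_finite _ E₃ h₃
    ThmN.RLS (PercRepro.Matroid.truncate
      ((M.disjointSum ((Matroid.freeOn (Set.univ : Set β)).comapOn (E₂ : Set α) c) h).disjointSum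
        (Matroid.freeOn (E₃ : Set α)) h₃) r) p q := by
  haveI := disjointSum_comapOn_finite M c E₂ h
  haveI := PLDBridge.disjointSum_freeOn_finite _ E₃ h₃
  haveI := ParallelPLD.comapOn_finite c E₂
  have h' : Disjoint (Matroid.truncate M g).E (E₂ : Set α) := by rwa [Matroid.truncate_ground]
  haveI := disjointSum_comapOn_finite (Matroid.truncate M g) c E₂ h'
  have h₃' : Disjoint ((Matroid.truncate M g).disjointSum
      ((Matroid.freeOn (Set.univ : Set β)).comapOn (E₂ : Set α) c) h').E (E₃ : Set α) := by
    rw [Matroid.disjointSum_ground_eq, Matroid.truncate_ground]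
    rwa [Matroid.disjointSum_ground_eq] at h₃
  haveI := PLDBridge.disjointSum_freeOn_finite _ E₃ h₃'
  haveI : (Matroid.freeOn (E₃ : Set α)).Finite := ⟨by rw [Matroid.freeOn_ground]; exact E₃.finite_toSet⟩
  have key := rls_truncate_paving_parallelClasses_freeOn (Matroid.truncate M g)
    (PavingPLD.truncate_paving_of_girth M g hg) c E₂ h' E₃ h₃' r p q
  -- the two direct sums commute with the truncation at the girth
  have h₃'' : Disjoint (Matroid.truncate (M.disjointSum
      ((Matroid.freeOn (Set.univ : Set β)).comapOn (E₂ : Set α) c) h) g).E (E₃ : Set α) := by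
    rwa [Matroid.truncate_ground]
  have e1 := PavingPLD.truncate_disjointSum_truncate
    (M.disjointSum ((Matroid.freeOn (Set.univ : Set β)).comapOn (E₂ : Set α) c) h)
    (Matroid.freeOn (E₃ : Set α)) g r hr h₃ h₃''
  have e2 := PavingPLD.truncate_disjointSum_truncate M
    ((Matroid.freeOn (Set.univ : Set β)).comapOn (E₂ : Set α) c) g g le_rfl h h'
  have h₃''' : Disjoint (Matroid.truncate ((Matroid.truncate M g).disjointSum
      ((Matroid.freeOn (Set.univ : Set β)).comapOn (E₂ : Set α) c) h') g).E (E₃ : Set α) := by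
    rwa [Matroid.truncate_ground]
  have e3 := PavingPLD.truncate_disjointSum_truncate
    ((Matroid.truncate M g).disjointSum ((Matroid.freeOn (Set.univ : Set β)).comapOn (E₂ : Set α) c) h')
    (Matroid.freeOn (E₃ : Set α)) g r hr h₃' h₃'''
  -- replacing the truncated sum by its equal (e2) under the outer sum: generalise, then `subst`
  have gen : ∀ (X : Matroid α) [X.Finite] (hX : Disjoint X.E (E₃ : Set α)),
      X = Matroid.truncate ((Matroid.truncate M g).disjointSum
        ((Matroid.freeOn (Set.univ : Set β)).comapOn (E₂ : Set α) c) h') g →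
      haveI := PLDBridge.disjointSum_freeOn_finite X E₃ hX
      haveI := PLDBridge.disjointSum_freeOn_finite _ E₃ h₃'''
      Matroid.truncate (X.disjointSum (Matroid.freeOn (E₃ : Set α)) hX) r =
        Matroid.truncate ((Matroid.truncate ((Matroid.truncate M g).disjointSum
          ((Matroid.freeOn (Set.univ : Set β)).comapOn (E₂ : Set α) c) h') g).disjointSum
          (Matroid.freeOn (E₃ : Set α)) h₃''') r := by
    intro X _ hX hXe
    subst hXe
    rfl
  have heq : Matroid.truncate ((M.disjointSum ((Matroid.freeOn (Set.univ : Set β)).comapOn (E₂ : Set α) c) h).disjointSum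
      (Matroid.freeOn (E₃ : Set α)) h₃) r = Matroid.truncate (((Matroid.truncate M g).disjointSum
      ((Matroid.freeOn (Set.univ : Set β)).comapOn (E₂ : Set α) c) h').disjointSum (Matroid.freeOn (E₃ : Set α)) h₃') r := by
    rw [e1, e3]
    exact gen _ h₃'' e2
  convert key using 2

/-! ### The complement symmetry of the rank profile -/

/-- THE COMPLEMENT SYMMETRY: for every finite matroid and every `F`, `Σ_{I ⊆ E} F (ρ I) (ρ (E ∖ I)) =
Σ_{I ⊆ E} F (ρ (E ∖ I)) (ρ I)` — the involution `I ↦ E ∖ I` of the subsets. -/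
theorem sum_complement (M : Matroid α) [M.Finite] (F : ℕ → ℕ → ℕ) :
    ∑ I ∈ (gr M).powerset, F (M.eRk (I : Set α)).toNat (M.eRk ((gr M \ I : Finset α) : Set α)).toNat =
      ∑ I ∈ (gr M).powerset, F (M.eRk ((gr M \ I : Finset α) : Set α)).toNat (M.eRk (I : Set α)).toNat := by
  refine Finset.sum_nbij' (fun I => gr M \ I) (fun I => gr M \ I) ?_ ?_ ?_ ?_ ?_
  · intro I _
    exact mem_powerset.2 sdiff_subset
  · intro I _
    exact mem_powerset.2 sdiff_subset
  · intro I hI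
    exact Finset.sdiff_sdiff_eq_self (mem_powerset.1 hI)
  · intro I hI
    exact Finset.sdiff_sdiff_eq_self (mem_powerset.1 hI)
  · intro I hI
    rw [Finset.sdiff_sdiff_eq_self (mem_powerset.1 hI)]

end PLDClosure

end PercRepro
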